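import Mathlib
import Summits.NavierStokesRegularity.NavierStokesRegularity.Theorems.TaoLadderRungTwoBreakOneShiftT4W76RRows
import HarnessLib

/-!
# The one-shift instance T4 @ ε₀ = 1/10, W = 76, REPLAY-SIZED VARIANT (R): the TOP AMPLITUDE ANCHOR RE-SIZED to the replay's
# padding boxes — `ā_t = 3·10⁻²⁴`, the functions `AT4₂ / RT4₂ / vmaxT4₂ / χbT4₂ / χeT4₂` fed to `…_v7s`, and the rows that read them
# (cell harvest/h2-tao-ladder, seat p2; rung1/RUNG1-P2G16-REPORT.md §79–§80; support for K1(1) = `NoSurvivingDSSOne`,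
# stmt-NavierStokesRegularity-20205)

MODEL lattice only (Tao-type averaged cascade with the comparable circuit table T4, scale ratio `11/10`);
nothing here is a statement about the Navier–Stokes equations; no item is closed.

Why.  `…T4W76RDefs` kept the top amplitude anchor `ā_t = T4W76.abart = 1.01·10⁻²⁴` (the ENGINE's hull of the last window shell, rounded up).
The certificate clause `hAwin` asks `|x_{i,75}(s)| ≤ A(75)` for EVERY admissible point — in particular at `s = 0`, where the admissible window
states fill the Krawczyk box.  The kernel replay's box (emitter of p2 g15, kit j325299) has centre `0` and radius `2⁻⁷⁹ = 1.654·10⁻²⁴` on every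
window shell `57 … 75` (the engine's `ŷ` there is `< 2⁻¹⁰⁰`, zeroed; radii = powers of two `≥ ρσ`): `A(75) ≤ 1.01·10⁻²⁴` is therefore unservable by
that data, whatever Boolean one writes.  This module re-sizes the anchor to `ā_t = 3·10⁻²⁴` (1.81× the padding radius), with the top rate envelope
`(S ā_t² Λ₀⁷⁶)(Λ₀ ϑ²)^{k−76}` and the shell-`75` Lipschitz triple `(10⁻¹³, 10⁻¹³, 10¹⁷)` re-sized so that the top contraction row still closes
(`q = 13/25`; margins: `hrowT` 7.0×, `hfirstT` 3.8×; python exact-rational twin rung1/num4c/inst_T4W76R2_exact.py, 76/76 OK).  The frame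
`T4W76R.frame` is untouched (it does not read `ā_t`).  Price on the data side: the emitted top-tail slope bound `RW` must dominate
`S ā_t² Λ₀⁷⁶ = 1.47·10⁻³⁹` (the package of record carries `1.68·10⁻⁴⁰`): the Krawczyk module is re-emitted with the larger `RW` (groups D/K of
the kernel wave re-evaluated; the step / product Booleans do not read `RW`).  The superseded `T4W76R.AT4 / RT4 / vmaxT4 / χbT4 / χeT4` and their rows
stay in `…T4W76RDefs/…RRows` unused.
-/

noncomputable section

-- the sub-problem namespace repeats the summit name by design (D-0017)
set_option linter.dupNamespace false

namespace Summit.NavierStokesRegularity.NavierStokesRegularity.Theorems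

namespace DSSOneShift

open Set Literature.Analysis.FluidPDE Literature.Analysis.FluidPDE.TaoCascade CertificateGlueOn
open OneShiftFrame (quadTermLip tableAbsSum quadTermLip_le_of_bounds)

namespace T4W76R

open T4W76 (ghat κw cmax Q S εR ωt τc rτ αT4 BoxData tubeCT4 bigLam_tenth_bounds bigLam_tenth_pow_76
  tableAbsSum_αT4_le tableAbsSum_nonneg toNat_two τhi_nonneg)

/-! ### The re-sized top anchor and the functions fed to `…_v7s` -/

/-- Top amplitude anchor RE-SIZED to the replay's padding boxes: `ā_t = 3·10⁻²⁴ ≥ 2⁻⁷⁹ = 1.654·10⁻²⁴` (box radius of the zero-centred window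
shells `57…75` in the kernel replay). [cite: Tao2016AveragedNS, §4; cell vocabulary, harvest/h2-tao-ladder rung1/RUNG1-P2G16-REPORT.md §80] -/
def abart₂ : ℝ := 3 / 10 ^ 24

/-- Amplitude hulls `A`: `Q β^{|k|}` (wake), `ε ϑ^{k-76}` (top), and on the window `Q` (shell 0), `ā_t = 3·10⁻²⁴` (shell 75), `1` (shells 1…74,
never read by a row). [cite: Tao2016AveragedNS, §4 Lemma 4.1 (4.5); cell vocabulary, harvest/h2-tao-ladder rung1/RUNG1-P2G16-REPORT.md §80] -/
def AT4₂ (k : ℤ) : ℝ :=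
  if k < 0 then Q * βw ^ (-k).toNat
  else if 76 ≤ k then εR * ϑt ^ (k - 76).toNat
  else if k = 0 then Q else if k = 75 then abart₂ else 1

/-- Time-Lipschitz rate envelopes `R` (table-sparse form of `…_v7s`) with the re-sized top anchor: `(S Q² β²)(β²/Λ₀)^{|k|}` on the wake,
`(S ā_t² Λ₀^76)(Λ₀ ϑ²)^{k-76}` on the top, `0` on the window. [cite: Tao2016AveragedNS, §4 Lemma 4.1 (4.8); cell vocabulary, module …OneShiftSparseClosedForm (hRW/hRT)] -/
def RT4₂ (k : ℤ) : ℝ :=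
  if k < 0 then (S * Q ^ 2 * βw ^ 2) * (βw ^ 2 * (bigLam (1 / 10))⁻¹) ^ (-k).toNat
  else if 76 ≤ k then (S * abart₂ ^ 2 * bigLam (1 / 10) ^ 76) * (bigLam (1 / 10) * ϑt ^ 2) ^ (k - 76).toNat
  else 0

/-- Per-shell window Lipschitz numbers w.r.t. the point distance (three pieces: `10⁻³ / 1 / 10⁻¹³`). [cite: Tao2016AveragedNS, §4; cell vocabulary, harvest/h2-tao-ladder rung1/RUNG1-P2G16-REPORT.md §80] -/
def vmaxT4₂ (k : ℤ) : ℝ :=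
  if k = 0 then 1 / 10 ^ 3 else if k = 75 then 1 / 10 ^ 13 else 1

/-- Per-shell window Lipschitz numbers w.r.t. the wake-edge input (three pieces: `10⁻³ / 1 / 10⁻¹³`). [cite: Tao2016AveragedNS, §4; cell vocabulary, harvest/h2-tao-ladder rung1/RUNG1-P2G16-REPORT.md §80] -/
def χbT4₂ (k : ℤ) : ℝ :=
  if k = 0 then 1 / 10 ^ 3 else if k = 75 then 1 / 10 ^ 13 else 1

/-- Per-shell window Lipschitz numbers w.r.t. the top-edge input (three pieces: `10²⁰ / 10²⁸ / 10¹⁷`). [cite: Tao2016AveragedNS, §4; cell vocabulary, harvest/h2-tao-ladder rung1/RUNG1-P2G16-REPORT.md §80] -/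
def χeT4₂ (k : ℤ) : ℝ :=
  if k = 0 then 10 ^ 20 else if k = 75 then 10 ^ 17 else 10 ^ 28

/-! ### Their values and the rows of `…_v7s` that read them (`q = 13/25`) -/

/-- [folklore] -/
theorem AT4₂_nonneg (k : ℤ) : 0 ≤ T4W76R.AT4₂ k := by
  unfold AT4₂ βw gHi ϑt T4W76.Q T4W76.εR abart₂; split_ifs <;> positivity

/-- [folklore] -/
theorem RT4₂_nonneg (k : ℤ) : 0 ≤ T4W76R.RT4₂ k := by
  have hpos : 0 < bigLam (1 / 10 : ℝ) := bigLam_pos (by norm_num)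
  unfold RT4₂ βw gHi ϑt T4W76.S T4W76.Q abart₂; split_ifs <;> positivity

/-- [folklore] -/
theorem vmaxT4₂_nonneg (k : ℤ) : 0 ≤ T4W76R.vmaxT4₂ k := by unfold vmaxT4₂; split_ifs <;> positivity

/-- [folklore] -/
theorem χbT4₂_nonneg (k : ℤ) : 0 ≤ T4W76R.χbT4₂ k := by unfold χbT4₂; split_ifs <;> positivity

/-- [folklore] -/
theorem χeT4₂_nonneg (k : ℤ) : 0 ≤ T4W76R.χeT4₂ k := by unfold χeT4₂; split_ifs <;> positivity

/-- [folklore] -/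
theorem AT4₂_wake (n : ℕ) : T4W76R.AT4₂ (-(n : ℤ) - 1) = Q * T4W76R.βw ^ (n + 1) := by
  have e : (-(-(n : ℤ) - 1)).toNat = n + 1 := by omega
  unfold AT4₂; rw [if_pos (by omega), e]

/-- [folklore] -/
theorem AT4₂_top (j : ℕ) : T4W76R.AT4₂ ((76 : ℤ) + (j : ℤ)) = εR * ϑt ^ j := by
  have e : ((76 : ℤ) + (j : ℤ) - 76).toNat = j := by omega
  unfold AT4₂; rw [if_neg (by omega), if_pos (by omega), e]

/-- [folklore] -/
theorem RT4₂_wake (j : ℕ) :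
    T4W76R.RT4₂ (-(j : ℤ) - 1) = (S * Q ^ 2 * T4W76R.βw ^ 2) * (T4W76R.βw ^ 2 * (bigLam (1 / 10))⁻¹) ^ (j + 1) := by
  have e : (-(-(j : ℤ) - 1)).toNat = j + 1 := by omega
  unfold RT4₂; rw [if_pos (by omega), e]

/-- [folklore] -/
theorem RT4₂_top (j : ℕ) : T4W76R.RT4₂ ((76 : ℤ) + (j : ℤ)) =
    (S * abart₂ ^ 2 * bigLam (1 / 10) ^ (76 : ℕ)) * (bigLam (1 / 10) * ϑt ^ 2) ^ j := by
  have e : ((76 : ℤ) + (j : ℤ) - 76).toNat = j := by omega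
  unfold RT4₂; rw [if_neg (by omega), if_pos (by omega), e]

/-- The amplitude hulls near the bottom edge are `≤ Q β²`. [folklore] -/
theorem AT4₂_le_bot (k' : ℤ) (h1 : -1 - 1 ≤ k') (h2 : k' ≤ -1 + 1) : T4W76R.AT4₂ k' ≤ Q * T4W76R.βw ^ 2 := by
  interval_cases k' <;> norm_num [AT4₂, T4W76.Q, βw, gHi, toNat_two]

/-- The amplitude hulls near the top edge are `≤ ā_t`. [folklore] -/
theorem AT4₂_le_top (k' : ℤ) (h1 : (76 : ℤ) - 1 ≤ k') (h2 : k' ≤ (76 : ℤ) + 1) : T4W76R.AT4₂ k' ≤ abart₂ := by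
  interval_cases k' <;> norm_num [AT4₂, abart₂, T4W76.εR, ϑt]

variable (bd : BoxData)

/-- The distance coefficients near the bottom edge are in `[0, θ²]`. [folklore] -/
theorem D_le_bot₂ (k' : ℤ) (h1 : -1 - 1 ≤ k') (h2 : k' ≤ -1 + 1) :
    (0 ≤ (if (T4W76R.frame bd).InWindow k' then
        vmaxT4₂ k' + χbT4₂ k' * (T4W76R.frame bd).wt (-1) + χeT4₂ k' * (T4W76R.frame bd).wt (T4W76R.frame bd).W else (T4W76R.frame bd).wt k')) ∧
    (if (T4W76R.frame bd).InWindow k' then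
        vmaxT4₂ k' + χbT4₂ k' * (T4W76R.frame bd).wt (-1) + χeT4₂ k' * (T4W76R.frame bd).wt (T4W76R.frame bd).W else (T4W76R.frame bd).wt k')
      ≤ θw ^ 2 := by
  interval_cases k' <;>
    norm_num [OneShiftFrame.InWindow, frame, wtT4, vmaxT4₂, χbT4₂, χeT4₂, θw, gHi, T4W76.ωt, toNat_two]

/-- The distance coefficients near the top edge are in `[0, 4·10⁻¹³]`. [folklore] -/
theorem D_le_top₂ (k' : ℤ) (h1 : ((T4W76R.frame bd).W : ℤ) - 1 ≤ k') (h2 : k' ≤ ((T4W76R.frame bd).W : ℤ) + 1) :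
    (0 ≤ (if (T4W76R.frame bd).InWindow k' then
        vmaxT4₂ k' + χbT4₂ k' * (T4W76R.frame bd).wt (-1) + χeT4₂ k' * (T4W76R.frame bd).wt (T4W76R.frame bd).W else (T4W76R.frame bd).wt k')) ∧
    (if (T4W76R.frame bd).InWindow k' then
        vmaxT4₂ k' + χbT4₂ k' * (T4W76R.frame bd).wt (-1) + χeT4₂ k' * (T4W76R.frame bd).wt (T4W76R.frame bd).W else (T4W76R.frame bd).wt k')
      ≤ 4 / 10 ^ 13 := by
  rw [frame_W] at h1 h2
  interval_cases k' <;>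
    norm_num [OneShiftFrame.InWindow, frame, wtT4, vmaxT4₂, χbT4₂, χeT4₂, θw, gHi, T4W76.ωt, ϑt, toNat_two]

/-- [folklore] -/
theorem AT4₂_le_top' (k' : ℤ) (h1 : ((T4W76R.frame bd).W : ℤ) - 1 ≤ k') (h2 : k' ≤ ((T4W76R.frame bd).W : ℤ) + 1) :
    T4W76R.AT4₂ k' ≤ abart₂ := by
  rw [frame_W] at h1 h2; exact AT4₂_le_top k' h1 h2

/-- Row `hRBm1` (table-sparse rate at the wake edge). [cite: Tao2016AveragedNS, §4 (4.8); cell vocabulary, harvest/h2-tao-ladder rung1/INSTANCE-SHEET-T4-0.1-W76.md] -/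
theorem row_RBm1₂ (i : Fin 4) : quadTermLip (1 / 10) αT4 T4W76R.AT4₂ T4W76R.AT4₂ i (-1) ≤ 2 * T4W76R.RT4₂ (-1) := by
  have hε : (0 : ℝ) < 1 + 1 / 10 := by norm_num
  have hΛ1 : 1 ≤ bigLam (1 / 10 : ℝ) := one_le_bigLam (by norm_num)
  have hpos : 0 < bigLam (1 / 10 : ℝ) := bigLam_pos (by norm_num)
  have hS := tableAbsSum_αT4_le i
  have henv := quadTermLip_le_of_bounds hε hΛ1 αT4 (n := -1) (fun k' _ _ => AT4₂_nonneg k')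
    (fun k' _ _ => AT4₂_nonneg k') AT4₂_le_bot AT4₂_le_bot i
  have hR := RT4₂_wake 0
  norm_num at hR
  rw [zpow_neg_one] at henv
  rw [hR]
  have hL0 : 0 ≤ (bigLam (1 / 10 : ℝ))⁻¹ := by positivity
  have hTL : tableAbsSum αT4 i * (bigLam (1 / 10))⁻¹ ≤ S * (bigLam (1 / 10))⁻¹ :=
    mul_le_mul_of_nonneg_right hS hL0
  unfold T4W76.S T4W76.Q βw gHi at *
  nlinarith [hTL, henv, hL0]

/-- Row `hRBW` (table-sparse rate at the top edge). [cite: Tao2016AveragedNS, §4 (4.8); cell vocabulary, harvest/h2-tao-ladder rung1/INSTANCE-SHEET-T4-0.1-W76.md] -/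
theorem row_RBW₂ (i : Fin 4) :
    quadTermLip (1 / 10) αT4 T4W76R.AT4₂ T4W76R.AT4₂ i ((T4W76R.frame bd).W : ℤ) ≤ 2 * T4W76R.RT4₂ ((T4W76R.frame bd).W : ℤ) := by
  have hε : (0 : ℝ) < 1 + 1 / 10 := by norm_num
  have hΛ1 : 1 ≤ bigLam (1 / 10 : ℝ) := one_le_bigLam (by norm_num)
  have hS := tableAbsSum_αT4_le i
  have henv := quadTermLip_le_of_bounds hε hΛ1 αT4 (n := ((T4W76R.frame bd).W : ℤ)) (fun k' _ _ => AT4₂_nonneg k')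
    (fun k' _ _ => AT4₂_nonneg k') (AT4₂_le_top' bd) (AT4₂_le_top' bd) i
  have hR := RT4₂_top 0
  simp only [Nat.cast_zero, add_zero, pow_zero, mul_one] at hR
  rw [frame_W] at henv ⊢
  rw [zpow_ofNat, bigLam_tenth_pow_76] at henv
  rw [hR, bigLam_tenth_pow_76]
  unfold T4W76.S abart₂ at *
  nlinarith [hS, henv]

/-- Row `hrowB` (contraction row at the wake edge `k = -1`, reading the window bottom; shell-0 numbers `(10⁻³, 10⁻³, 10²⁰)`,
`γ = (10⁻⁶, 10⁻⁶, 10²²)`). [cite: Tao2016AveragedNS, §4 (4.8), §5.3; cell vocabulary, harvest/h2-tao-ladder rung1/STAGE3-BANACH.md §2] -/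
theorem row_B₂ (i : Fin 4) :
    gHi * (1 / 10 ^ 3 + 1 / 10 ^ 3 * (T4W76R.frame bd).wt (-1) + 10 ^ 20 * (T4W76R.frame bd).wt (T4W76R.frame bd).W) +
      AT4₂ 0 * (1 / 10 ^ 6 + 1 / 10 ^ 6 * (T4W76R.frame bd).wt (-1) + 10 ^ 22 * (T4W76R.frame bd).wt (T4W76R.frame bd).W) +
      (T4W76R.frame bd).τhi * quadTermLip (1 / 10) αT4 AT4₂
        (fun k' => if (T4W76R.frame bd).InWindow k' then
          vmaxT4₂ k' + χbT4₂ k' * (T4W76R.frame bd).wt (-1) + χeT4₂ k' * (T4W76R.frame bd).wt (T4W76R.frame bd).W else (T4W76R.frame bd).wt k')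
        i (-1) ≤ 13 / 25 * (T4W76R.frame bd).wt (-1) := by
  have hε : (0 : ℝ) < 1 + 1 / 10 := by norm_num
  have hΛ1 : 1 ≤ bigLam (1 / 10 : ℝ) := one_le_bigLam (by norm_num)
  have hpos : 0 < bigLam (1 / 10 : ℝ) := bigLam_pos (by norm_num)
  have hS := tableAbsSum_αT4_le i
  have hS0 := tableAbsSum_nonneg i
  have henv := quadTermLip_le_of_bounds hε hΛ1 αT4 (n := -1) (fun k' _ _ => AT4₂_nonneg k')
    (fun k' h1 h2 => (D_le_bot₂ bd k' h1 h2).1) AT4₂_le_bot (fun k' h1 h2 => (D_le_bot₂ bd k' h1 h2).2) i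
  rw [zpow_neg_one] at henv
  have hL1 : (bigLam (1 / 10 : ℝ))⁻¹ ≤ 1 := inv_le_one_of_one_le₀ hΛ1
  have hL0 : 0 ≤ (bigLam (1 / 10 : ℝ))⁻¹ := by positivity
  have hTL : tableAbsSum αT4 i * (bigLam (1 / 10))⁻¹ ≤ S * 1 := mul_le_mul hS hL1 hL0 (hS0.trans hS)
  have key := mul_le_mul_of_nonneg_left henv (τhi_nonneg)
  have hA0 : AT4₂ 0 = Q := by norm_num [AT4₂]
  rw [frame_τhi]
  simp only [frame_wt, frame_W, wtT4_m1, wtT4_76, hA0] at key ⊢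
  unfold T4W76.S T4W76.Q βw θw gHi T4W76.ωt T4W76.τc T4W76.rτ at *
  nlinarith [key, hTL]

/-- Row `hrowT` (contraction row at the top edge `k = W`, reading the window top; shell-75 numbers `(10⁻¹², 10⁻¹², 10¹⁸)`).
[cite: Tao2016AveragedNS, §4 (4.8), §5.3; cell vocabulary, harvest/h2-tao-ladder rung1/STAGE3-BANACH.md §2] -/
theorem row_T₂ (i : Fin 4) :
    gHi * ((T4W76R.frame bd).wt (((T4W76R.frame bd).W : ℤ) + 1) + RT4₂ (((T4W76R.frame bd).W : ℤ) + 1) * (T4W76R.frame bd).rτ) +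
      AT4₂ (((T4W76R.frame bd).W : ℤ) + 1) *
        (1 / 10 ^ 6 + 1 / 10 ^ 6 * (T4W76R.frame bd).wt (-1) + 10 ^ 22 * (T4W76R.frame bd).wt (T4W76R.frame bd).W) +
      (T4W76R.frame bd).τhi * quadTermLip (1 / 10) αT4 AT4₂
        (fun k' => if (T4W76R.frame bd).InWindow k' then
          vmaxT4₂ k' + χbT4₂ k' * (T4W76R.frame bd).wt (-1) + χeT4₂ k' * (T4W76R.frame bd).wt (T4W76R.frame bd).W else (T4W76R.frame bd).wt k')
        i (T4W76R.frame bd).W ≤ 13 / 25 * (T4W76R.frame bd).wt (T4W76R.frame bd).W := by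
  have hε : (0 : ℝ) < 1 + 1 / 10 := by norm_num
  have hΛ1 : 1 ≤ bigLam (1 / 10 : ℝ) := one_le_bigLam (by norm_num)
  have hpos : 0 < bigLam (1 / 10 : ℝ) := bigLam_pos (by norm_num)
  obtain ⟨-, hΛhi⟩ := bigLam_tenth_bounds
  have hS := tableAbsSum_αT4_le i
  have hS0 := tableAbsSum_nonneg i
  have henv := quadTermLip_le_of_bounds hε hΛ1 αT4 (n := ((T4W76R.frame bd).W : ℤ)) (fun k' _ _ => AT4₂_nonneg k')
    (fun k' h1 h2 => (D_le_top₂ bd k' h1 h2).1) (AT4₂_le_top' bd) (fun k' h1 h2 => (D_le_top₂ bd k' h1 h2).2) i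
  have key := mul_le_mul_of_nonneg_left henv (τhi_nonneg)
  have hw77 : wtT4 (76 + 1) = ωt * ϑt ^ 1 := by exact_mod_cast wtT4_top 1
  have hA77 : AT4₂ (76 + 1) = εR * ϑt ^ 1 := by exact_mod_cast AT4₂_top 1
  have hR77 : RT4₂ (76 + 1) = (S * abart₂ ^ 2 * bigLam (1 / 10) ^ (76 : ℕ)) * (bigLam (1 / 10) * ϑt ^ 2) ^ 1 := by
    exact_mod_cast RT4₂_top 1
  rw [frame_τhi, frame_rτ]
  simp only [frame_wt, frame_W, wtT4_m1, wtT4_76, hw77, hA77, hR77, pow_one, zpow_ofNat,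
    bigLam_tenth_pow_76] at key ⊢
  have hTΛ : tableAbsSum αT4 i ≤ S := hS
  have hRb : S * abart₂ ^ 2 * ((161051 : ℝ) / 100000) ^ 38 * (bigLam (1 / 10) * ϑt ^ 2) ≤
      S * abart₂ ^ 2 * ((161051 : ℝ) / 100000) ^ 38 * (12691 / 10000 * ϑt ^ 2) := by
    unfold T4W76.S abart₂ ϑt; gcongr
  unfold T4W76.S abart₂ θw gHi T4W76.ωt T4W76.εR ϑt T4W76.τc T4W76.rτ at *
  nlinarith [key, hTΛ, hRb]

/-- Row `hfirstT` (first interior top contraction row `k = W+1`, top ratio `1/16`). [cite: Tao2016AveragedNS, §4 (4.8); cell vocabulary, harvest/h2-tao-ladder rung1/STAGE3-BANACH.md §2 (θ_t)] -/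
theorem row_firstT₂ (i : Fin 4) :
    gHi * (ωt * ϑt ^ 2 +
        (S * abart₂ ^ 2 * bigLam (1 / 10) ^ (T4W76R.frame bd).W) * (bigLam (1 / 10) * ϑt ^ 2) ^ 2 * (T4W76R.frame bd).rτ) +
      (abart₂ * ϑt) * ϑt ^ 2 *
        (1 / 10 ^ 6 + 1 / 10 ^ 6 * (T4W76R.frame bd).wt (-1) + 10 ^ 22 * (T4W76R.frame bd).wt (T4W76R.frame bd).W) +
      (T4W76R.frame bd).τhi * (2 * tableAbsSum αT4 i * bigLam (1 / 10) ^ ((T4W76R.frame bd).W + 1) * ωt * (abart₂ * ϑt)) ≤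
      13 / 25 * (ωt * ϑt) := by
  have hpos : 0 < bigLam (1 / 10 : ℝ) := bigLam_pos (by norm_num)
  obtain ⟨-, hΛhi⟩ := bigLam_tenth_bounds
  have h2 : bigLam (1 / 10 : ℝ) ^ 2 = 161051 / 100000 := by rw [bigLam_sq (by norm_num)]; norm_num
  have hS := tableAbsSum_αT4_le i
  have hS0 := tableAbsSum_nonneg i
  have hTΛ : tableAbsSum αT4 i * bigLam (1 / 10) ≤ S * (12691 / 10000) := mul_le_mul hS hΛhi hpos.le (hS0.trans hS)
  have h77 : bigLam (1 / 10 : ℝ) ^ ((T4W76R.frame bd).W + 1) = (161051 / 100000) ^ 38 * bigLam (1 / 10) := by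
    rw [frame_W', pow_succ, bigLam_tenth_pow_76]
  have h76 : bigLam (1 / 10 : ℝ) ^ (T4W76R.frame bd).W = (161051 / 100000) ^ 38 := by
    rw [frame_W', bigLam_tenth_pow_76]
  rw [h77, h76, frame_τhi, frame_rτ]
  simp only [frame_wt, frame_W, wtT4_m1, wtT4_76]
  unfold T4W76.S abart₂ θw gHi T4W76.ωt ϑt T4W76.τc T4W76.rτ at *
  nlinarith [hTΛ, h2]

/-- Row `hfirstTS` (top self-map row). [cite: Tao2016AveragedNS, §4 (4.8); cell vocabulary, harvest/h2-tao-ladder rung1/STAGE2-LEMMA.md §5 (Lemma 4b)] -/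
theorem row_firstTS₂ :
    gHi * (εR * ϑt) + (T4W76R.frame bd).τhi * (S * abart₂ ^ 2 * bigLam (1 / 10) ^ (T4W76R.frame bd).W) ≤ εR := by
  rw [frame_τhi, frame_W', bigLam_tenth_pow_76]
  unfold gHi T4W76.εR ϑt T4W76.S abart₂ T4W76.τc T4W76.rτ
  norm_num

/-- Row `hrow1` (wake entry row, `A₁ = 10⁻⁵`). [cite: Tao2016AveragedNS, §5.3; cell vocabulary, harvest/h2-tao-ladder rung1/STAGE2-LEMMA.md §5] -/
theorem row_1₂ : 1 / 10 ^ 5 + (T4W76R.frame bd).τhi * RT4₂ (-1) ≤ (T4W76R.frame bd).tubeR (-1) := by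
  have hΛ1 : 1 ≤ bigLam (1 / 10 : ℝ) := one_le_bigLam (by norm_num)
  have hpos : 0 < bigLam (1 / 10 : ℝ) := bigLam_pos (by norm_num)
  have hL1 : (bigLam (1 / 10 : ℝ))⁻¹ ≤ 1 := inv_le_one_of_one_le₀ hΛ1
  have hR := RT4₂_wake 0
  norm_num at hR
  have ht : tubeRT4 (-1) = gHi * (r₀ + κw) := by norm_num [tubeRT4]
  rw [frame_τhi, frame_tubeR, hR, ht]
  unfold T4W76.S T4W76.Q βw gHi r₀ T4W76.κw T4W76.τc T4W76.rτ
  nlinarith [hL1]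

end T4W76R

end DSSOneShift

end Summit.NavierStokesRegularity.NavierStokesRegularity.Theorems
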